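import Summits.MatrixMultiplication.MatrixMultiplication.Theorems.SoloBlindHThreeSeqStructure
import Summits.MatrixMultiplication.MatrixMultiplication.Theorems.SoloBlindWindowThree

/-!
# H(3) = 4 for sequences in all ranks, and the window inequality (E≤3) (solo-blind, door I1⁗ / (K₃), s80)

MAIN THEOREM `soloBlind_seqRep_three_card_le_four_of_hgood`: for `h : ι → G` (`G` abelian of exponent `3`)
zero-sum free on `S` and `τ` H-good (no sub-sum equals `τ + τ`),

  H(3)   N_3(τ) = #{M ⊆ S : |M| = 3, ∑_{i ∈ M} h i = τ} ≤ 4,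

previously a census theorem (K ≤ 5), here structurally and in all ranks.  Proof: if some member has a repeated
value it is the only member (`soloBlind_seqRep_three_card_eq_one_of_twin_member`); otherwise group the members
into FIBRES over their value triples (`soloBlindFib`; at most three value triples by
`soloBlind_valueTriples_card_le_three`): a fibre has at most `4` members (`soloBlind_fib_card_le_four`: some index
is twin-free, the other two value classes have ≤ 2 indices each), at most `2` if another value triple exists
(`soloBlind_fib_card_le_two_of_other`, via `soloBlind_two_twins_alone`), and among three value triples at most one
fibre has `2` members (`soloBlind_triangle_two_twins`).  COROLLARY `soloBlind_window_three`: the window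
inequality (E≤3) `N_3 + 2 N_2 + 4 N_1 ≤ 4` holds unconditionally (with `SoloBlindWindowThree`), i.e. the
Kraft sum of the layers `k ≤ 3` of an H-good target is at most `1/2`.
-/

namespace Summit.MatrixMultiplication.MatrixMultiplication.Theorems

open Finset

variable {ι G : Type*} [DecidableEq ι] [AddCommGroup G] [DecidableEq G]

section DistinctValued

variable {h : ι → G} {S : Finset ι} {τ : G}

/-! ### Fibres of the value map -/

/-- The fibre of a value triple: the members with that value triple. -/
def soloBlindFib (h : ι → G) (S : Finset ι) (τ : G) (V : Finset G) : Finset (Finset ι) :=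
  (soloBlindSeqRep h S 3 τ).filter (fun M => M.image h = V)

omit [DecidableEq ι] in
/-- Membership in a fibre. -/
theorem soloBlind_mem_fib {V : Finset G} {M : Finset ι} :
    M ∈ soloBlindFib h S τ V ↔ M ∈ soloBlindSeqRep h S 3 τ ∧ M.image h = V := by
  simp only [soloBlindFib, Finset.mem_filter]

/-- A member of the fibre of `M.image h` passing through a twin-free index `r ∈ M` is `{p°, q°, r}` with
`h p° = h p`, `h q° = h q`; hence the fibre has at most four members. -/
theorem soloBlind_fib_card_le_four_of_twinfree (three : ∀ g : G, g + g + g = 0)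
    (zsf : ∀ T ⊆ S, T.Nonempty → ∑ i ∈ T, h i ≠ 0) {M : Finset ι} (hM : M ∈ soloBlindSeqRep h S 3 τ)
    (hc : (M.image h).card = 3) {r : ι} (hr : r ∈ M) (htf : ∀ r₂ ∈ S, h r₂ = h r → r₂ = r) :
    (soloBlindFib h S τ (M.image h)).card ≤ 4 := by
  obtain ⟨hMS, hMc, -⟩ := soloBlind_mem_seqRep.mp hM
  have hQc : (M.erase r).card = 2 := by rw [Finset.card_erase_of_mem hr, hMc]
  obtain ⟨p, q, hpq, hQ⟩ := Finset.card_eq_two.mp hQc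
  have hp : p ∈ M := Finset.mem_of_mem_erase (by rw [hQ]; exact Finset.mem_insert_self _ _)
  have hq : q ∈ M :=
    Finset.mem_of_mem_erase (by rw [hQ]; exact Finset.mem_insert_of_mem (Finset.mem_singleton_self _))
  have hpr : p ≠ r := by
    have : p ∈ M.erase r := by rw [hQ]; exact Finset.mem_insert_self _ _
    exact (Finset.mem_erase.mp this).1
  have hqr : q ≠ r := by
    have : q ∈ M.erase r := by rw [hQ]; exact Finset.mem_insert_of_mem (Finset.mem_singleton_self _)
    exact (Finset.mem_erase.mp this).1
  set A := S.filter (fun i => h i = h p) with hA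
  set B := S.filter (fun i => h i = h q) with hB
  have hcover : soloBlindFib h S τ (M.image h) ⊆
      (A ×ˢ B).image (fun x => insert x.1 (insert x.2 ({r} : Finset ι))) := by
    intro N hN
    obtain ⟨hN, hNV⟩ := soloBlind_mem_fib.mp hN
    obtain ⟨hNS, hNc, -⟩ := soloBlind_mem_seqRep.mp hN
    have hcN : (N.image h).card = 3 := by rw [hNV, hc]
    have memv : ∀ {j : ι}, j ∈ M → ∃ j' ∈ N, h j' = h j := by
      intro j hj
      have : h j ∈ N.image h := by rw [hNV]; exact Finset.mem_image_of_mem h hj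
      obtain ⟨j', hj'N, hj'v⟩ := Finset.mem_image.mp this
      exact ⟨j', hj'N, hj'v⟩
    obtain ⟨p', hp'N, hp'v⟩ := memv hp
    obtain ⟨q', hq'N, hq'v⟩ := memv hq
    obtain ⟨r', hr'N, hr'v⟩ := memv hr
    have hr' : r' = r := htf r' (hNS hr'N) hr'v
    rw [hr'] at hr'N
    have hpqv : h p ≠ h q := fun e => hpq (soloBlind_eq_of_value_eq hM hc hp hq e)
    have hprv : h p ≠ h r := fun e => hpr (soloBlind_eq_of_value_eq hM hc hp hr e)
    have hqrv : h q ≠ h r := fun e => hqr (soloBlind_eq_of_value_eq hM hc hq hr e)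
    have hp'q' : p' ≠ q' := fun e => hpqv (by rw [← hp'v, ← hq'v, e])
    have hp'r : p' ≠ r := fun e => hprv (by rw [← hp'v, e])
    have hq'r : q' ≠ r := fun e => hqrv (by rw [← hq'v, e])
    have hNeq : N = insert p' (insert q' {r}) := by
      symm
      apply Finset.eq_of_subset_of_card_le
      · exact Finset.insert_subset hp'N (Finset.insert_subset hq'N (Finset.singleton_subset_iff.mpr hr'N))
      · rw [hNc, Finset.card_eq_three.mpr ⟨p', q', r, hp'q', hp'r, hq'r, rfl⟩]
    rw [Finset.mem_image]
    refine ⟨(p', q'), ?_, hNeq.symm⟩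
    rw [Finset.mem_product]
    exact ⟨Finset.mem_filter.mpr ⟨hNS hp'N, hp'v⟩, Finset.mem_filter.mpr ⟨hNS hq'N, hq'v⟩⟩
  calc (soloBlindFib h S τ (M.image h)).card
      ≤ ((A ×ˢ B).image (fun x => insert x.1 (insert x.2 ({r} : Finset ι)))).card := Finset.card_le_card hcover
    _ ≤ (A ×ˢ B).card := Finset.card_image_le
    _ = A.card * B.card := Finset.card_product A B
    _ ≤ 2 * 2 := Nat.mul_le_mul (soloBlind_valueClass_card_le_two three h S zsf (h p))
        (soloBlind_valueClass_card_le_two three h S zsf (h q))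

/-- With two twin-free indices `q, r ∈ M` the fibre of `M.image h` has at most two members. -/
theorem soloBlind_fib_card_le_two_of_twinfree (three : ∀ g : G, g + g + g = 0)
    (zsf : ∀ T ⊆ S, T.Nonempty → ∑ i ∈ T, h i ≠ 0) {M : Finset ι} (hM : M ∈ soloBlindSeqRep h S 3 τ)
    (hc : (M.image h).card = 3) {q r : ι} (hq : q ∈ M) (hr : r ∈ M) (hqr : q ≠ r)
    (htfq : ∀ q₂ ∈ S, h q₂ = h q → q₂ = q) (htfr : ∀ r₂ ∈ S, h r₂ = h r → r₂ = r) :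
    (soloBlindFib h S τ (M.image h)).card ≤ 2 := by
  obtain ⟨hMS, hMc, -⟩ := soloBlind_mem_seqRep.mp hM
  obtain ⟨p, hp, hpq, hpr, hMeq⟩ := soloBlind_triple_third hMc hq hr hqr
  set A := S.filter (fun i => h i = h p) with hA
  have hcover : soloBlindFib h S τ (M.image h) ⊆ A.image (fun x => insert x (insert q ({r} : Finset ι))) := by
    intro N hN
    obtain ⟨hN, hNV⟩ := soloBlind_mem_fib.mp hN
    obtain ⟨hNS, hNc, -⟩ := soloBlind_mem_seqRep.mp hN
    have memv : ∀ {j : ι}, j ∈ M → ∃ j' ∈ N, h j' = h j := by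
      intro j hj
      have : h j ∈ N.image h := by rw [hNV]; exact Finset.mem_image_of_mem h hj
      obtain ⟨j', hj'N, hj'v⟩ := Finset.mem_image.mp this
      exact ⟨j', hj'N, hj'v⟩
    obtain ⟨p', hp'N, hp'v⟩ := memv hp
    obtain ⟨q', hq'N, hq'v⟩ := memv hq
    obtain ⟨r', hr'N, hr'v⟩ := memv hr
    have hq' : q' = q := htfq q' (hNS hq'N) hq'v
    have hr' : r' = r := htfr r' (hNS hr'N) hr'v
    rw [hq'] at hq'N
    rw [hr'] at hr'N
    have hpqv : h p ≠ h q := fun e => hpq (soloBlind_eq_of_value_eq hM hc hp hq e)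
    have hprv : h p ≠ h r := fun e => hpr (soloBlind_eq_of_value_eq hM hc hp hr e)
    have hp'q : p' ≠ q := fun e => hpqv (by rw [← hp'v, e])
    have hp'r : p' ≠ r := fun e => hprv (by rw [← hp'v, e])
    have hNeq : N = insert p' (insert q {r}) := by
      symm
      apply Finset.eq_of_subset_of_card_le
      · exact Finset.insert_subset hp'N (Finset.insert_subset hq'N (Finset.singleton_subset_iff.mpr hr'N))
      · rw [hNc, Finset.card_eq_three.mpr ⟨p', q, r, hp'q, hp'r, hqr, rfl⟩]
    rw [Finset.mem_image]
    exact ⟨p', Finset.mem_filter.mpr ⟨hNS hp'N, hp'v⟩, hNeq.symm⟩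
  calc (soloBlindFib h S τ (M.image h)).card
      ≤ (A.image (fun x => insert x (insert q ({r} : Finset ι)))).card := Finset.card_le_card hcover
    _ ≤ A.card := Finset.card_image_le
    _ ≤ 2 := soloBlind_valueClass_card_le_two three h S zsf (h p)

/-- Three twinned indices in one member are impossible (the twins form a disjoint member), so every fibre has
at most four members. -/
theorem soloBlind_fib_card_le_four (three : ∀ g : G, g + g + g = 0)
    (zsf : ∀ T ⊆ S, T.Nonempty → ∑ i ∈ T, h i ≠ 0) (hgood : ∀ T ⊆ S, ∑ i ∈ T, h i ≠ τ + τ)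
    {M : Finset ι} (hM : M ∈ soloBlindSeqRep h S 3 τ) (hc : (M.image h).card = 3) :
    (soloBlindFib h S τ (M.image h)).card ≤ 4 := by
  obtain ⟨hMS, hMc, hMsum⟩ := soloBlind_mem_seqRep.mp hM
  obtain ⟨p, q, r, hpq, hpr, hqr, hMeq⟩ := Finset.card_eq_three.mp hMc
  have hp : p ∈ M := by rw [hMeq]; exact Finset.mem_insert_self _ _
  have hq : q ∈ M := by rw [hMeq]; exact Finset.mem_insert_of_mem (Finset.mem_insert_self _ _)
  have hr : r ∈ M := by
    rw [hMeq]; exact Finset.mem_insert_of_mem (Finset.mem_insert_of_mem (Finset.mem_singleton_self _))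
  by_cases tp : ∀ p₂ ∈ S, h p₂ = h p → p₂ = p
  · exact soloBlind_fib_card_le_four_of_twinfree three zsf hM hc hp tp
  by_cases tq : ∀ q₂ ∈ S, h q₂ = h q → q₂ = q
  · exact soloBlind_fib_card_le_four_of_twinfree three zsf hM hc hq tq
  by_cases tr : ∀ r₂ ∈ S, h r₂ = h r → r₂ = r
  · exact soloBlind_fib_card_le_four_of_twinfree three zsf hM hc hr tr
  exfalso
  push Not at tp tq tr
  obtain ⟨p₂, hp₂S, hp₂v, hpp₂⟩ := tp
  obtain ⟨q₂, hq₂S, hq₂v, hqq₂⟩ := tq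
  obtain ⟨r₂, hr₂S, hr₂v, hrr₂⟩ := tr
  have hpqv : h p ≠ h q := fun e => hpq (soloBlind_eq_of_value_eq hM hc hp hq e)
  have hprv : h p ≠ h r := fun e => hpr (soloBlind_eq_of_value_eq hM hc hp hr e)
  have hqrv : h q ≠ h r := fun e => hqr (soloBlind_eq_of_value_eq hM hc hq hr e)
  have h12 : p₂ ≠ q₂ := fun e => hpqv (by rw [← hp₂v, ← hq₂v, e])
  have h13 : p₂ ≠ r₂ := fun e => hprv (by rw [← hp₂v, ← hr₂v, e])
  have h23 : q₂ ≠ r₂ := fun e => hqrv (by rw [← hq₂v, ← hr₂v, e])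
  have hmem : insert p₂ (insert q₂ ({r₂} : Finset ι)) ∈ soloBlindSeqRep h S 3 τ := by
    rw [soloBlind_mem_seqRep]
    refine ⟨Finset.insert_subset hp₂S (Finset.insert_subset hq₂S (Finset.singleton_subset_iff.mpr hr₂S)),
      Finset.card_eq_three.mpr ⟨p₂, q₂, r₂, h12, h13, h23, rfl⟩, ?_⟩
    rw [soloBlind_sum_triple h12 h13 h23, hp₂v, hq₂v, hr₂v, ← hMsum, hMeq, soloBlind_sum_triple hpq hpr hqr]
  refine soloBlind_hgood_not_disjoint hgood hmem hM (Finset.disjoint_left.mpr ?_)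
  intro a ha haM
  simp only [Finset.mem_insert, Finset.mem_singleton] at ha
  rcases ha with ha | ha | ha
  · rw [ha] at haM; exact hpp₂ (soloBlind_eq_of_value_eq hM hc haM hp hp₂v)
  · rw [ha] at haM; exact hqq₂ (soloBlind_eq_of_value_eq hM hc haM hq hq₂v)
  · rw [ha] at haM; exact hrr₂ (soloBlind_eq_of_value_eq hM hc haM hr hr₂v)

/-- If another value triple exists, the fibre of `M.image h` has at most two members (at most one index of
`M` is twinned, by `soloBlind_two_twins_alone`). -/
theorem soloBlind_fib_card_le_two_of_other (three : ∀ g : G, g + g + g = 0)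
    (zsf : ∀ T ⊆ S, T.Nonempty → ∑ i ∈ T, h i ≠ 0) (hgood : ∀ T ⊆ S, ∑ i ∈ T, h i ≠ τ + τ)
    {M M' : Finset ι} (hM : M ∈ soloBlindSeqRep h S 3 τ) (hM' : M' ∈ soloBlindSeqRep h S 3 τ)
    (hc : (M.image h).card = 3) (hc' : (M'.image h).card = 3) (hne : M.image h ≠ M'.image h) :
    (soloBlindFib h S τ (M.image h)).card ≤ 2 := by
  obtain ⟨hMS, hMc, -⟩ := soloBlind_mem_seqRep.mp hM
  obtain ⟨p, q, r, hpq, hpr, hqr, hMeq⟩ := Finset.card_eq_three.mp hMc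
  have hp : p ∈ M := by rw [hMeq]; exact Finset.mem_insert_self _ _
  have hq : q ∈ M := by rw [hMeq]; exact Finset.mem_insert_of_mem (Finset.mem_insert_self _ _)
  have hr : r ∈ M := by
    rw [hMeq]; exact Finset.mem_insert_of_mem (Finset.mem_insert_of_mem (Finset.mem_singleton_self _))
  have key : ∀ {x y : ι}, x ∈ M → y ∈ M → x ≠ y → ¬ (∀ x₂ ∈ S, h x₂ = h x → x₂ = x) →
      ¬ (∀ y₂ ∈ S, h y₂ = h y → y₂ = y) → False := by
    intro x y hx hy hxy tx ty
    push Not at tx ty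
    obtain ⟨x₂, hx₂S, hx₂v, hxx₂⟩ := tx
    obtain ⟨y₂, hy₂S, hy₂v, hyy₂⟩ := ty
    exact soloBlind_two_twins_alone three zsf hgood hM hM' hc hc' hne hx hy hxy hx₂S hxx₂ hx₂v hy₂S hyy₂ hy₂v
  by_cases tp : ∀ p₂ ∈ S, h p₂ = h p → p₂ = p
  · by_cases tq : ∀ q₂ ∈ S, h q₂ = h q → q₂ = q
    · exact soloBlind_fib_card_le_two_of_twinfree three zsf hM hc hp hq hpq tp tq
    · by_cases tr : ∀ r₂ ∈ S, h r₂ = h r → r₂ = r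
      · exact soloBlind_fib_card_le_two_of_twinfree three zsf hM hc hp hr hpr tp tr
      · exact (key hq hr hqr tq tr).elim
  · by_cases tq : ∀ q₂ ∈ S, h q₂ = h q → q₂ = q
    · by_cases tr : ∀ r₂ ∈ S, h r₂ = h r → r₂ = r
      · exact soloBlind_fib_card_le_two_of_twinfree three zsf hM hc hq hr hqr tq tr
      · exact (key hp hr hpr tp tr).elim
    · exact (key hp hq hpq tp tq).elim

omit [DecidableEq ι] in
/-- Two members with the same value triple give a twinned index in one of them. -/
theorem soloBlind_twin_of_two_le_fib {V : Finset G} (hV : 2 ≤ (soloBlindFib h S τ V).card) :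
    ∃ N ∈ soloBlindSeqRep h S 3 τ, N.image h = V ∧ ∃ a₁ ∈ N, ∃ a₂ ∈ S, a₂ ≠ a₁ ∧ h a₂ = h a₁ := by
  obtain ⟨N, hN, N', hN', hNN'⟩ := Finset.one_lt_card.mp hV
  obtain ⟨hNE, hNV⟩ := soloBlind_mem_fib.mp hN
  obtain ⟨hN'E, hN'V⟩ := soloBlind_mem_fib.mp hN'
  obtain ⟨-, hNc, -⟩ := soloBlind_mem_seqRep.mp hNE
  obtain ⟨hN'S, hN'c, -⟩ := soloBlind_mem_seqRep.mp hN'E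
  have hns : ¬ N ⊆ N' := fun hs => hNN' (Finset.eq_of_subset_of_card_le hs (by rw [hNc, hN'c]))
  obtain ⟨a₁, ha₁N, ha₁N'⟩ := Finset.not_subset.mp hns
  have : h a₁ ∈ N'.image h := by rw [hN'V, ← hNV]; exact Finset.mem_image_of_mem h ha₁N
  obtain ⟨a₂, ha₂N', ha₂v⟩ := Finset.mem_image.mp this
  exact ⟨N, hNE, hNV, a₁, ha₁N, a₂, hN'S ha₂N', fun e => ha₁N' (e ▸ ha₂N'), ha₂v⟩

end DistinctValued

/-! ### H(3) and the window inequality (E≤3) -/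

/-- H(3): for `h` zero-sum free on `S` (exponent-3 group) and `τ` H-good, at most FOUR 3-subsets of `S` have
`h`-sum `τ`.  All ranks, all lengths; equality is attained (`soloBlind_window_three_pair_attained` has `N_3 = 2`;
four members occur for squarefree value sets, e.g. the Steiner/W4 configurations of the K ≤ 5 census). -/
theorem soloBlind_seqRep_three_card_le_four_of_hgood (three : ∀ g : G, g + g + g = 0) (h : ι → G)
    (S : Finset ι) (zsf : ∀ T ⊆ S, T.Nonempty → ∑ i ∈ T, h i ≠ 0) (τ : G)
    (hgood : ∀ T ⊆ S, ∑ i ∈ T, h i ≠ τ + τ) : (soloBlindSeqRep h S 3 τ).card ≤ 4 := by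
  by_cases htw : ∃ M ∈ soloBlindSeqRep h S 3 τ, (M.image h).card < 3
  · obtain ⟨M, hM, hlt⟩ := htw
    obtain ⟨x, hx, x', hx', hxx', hv⟩ := soloBlind_exists_twin_of_card_image_lt hM hlt
    rw [soloBlind_seqRep_three_card_eq_one_of_twin_member three zsf hgood hM hx hx' hxx' hv.symm]
    norm_num
  push Not at htw
  have hdist : ∀ M ∈ soloBlindSeqRep h S 3 τ, (M.image h).card = 3 := by
    intro M hM
    have h1 := htw M hM
    have h2 : (M.image h).card ≤ M.card := Finset.card_image_le
    rw [(soloBlind_mem_seqRep.mp hM).2.1] at h2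
    omega
  set E := soloBlindSeqRep h S 3 τ with hE
  set W := E.image (fun M => M.image h) with hW
  have hWc : W.card ≤ 3 := soloBlind_valueTriples_card_le_three three zsf hgood hdist
  have hsum : E.card = ∑ V ∈ W, (soloBlindFib h S τ V).card := Finset.card_eq_sum_card_image _ _
  have rep : ∀ V ∈ W, ∃ M ∈ E, M.image h = V := fun V hV => Finset.mem_image.mp hV
  have f4 : ∀ V ∈ W, (soloBlindFib h S τ V).card ≤ 4 := by
    intro V hV
    obtain ⟨M, hM, rfl⟩ := rep V hV
    exact soloBlind_fib_card_le_four three zsf hgood hM (hdist M hM)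
  have f2 : ∀ V ∈ W, ∀ V' ∈ W, V ≠ V' → (soloBlindFib h S τ V).card ≤ 2 := by
    intro V hV V' hV' hVV'
    obtain ⟨M, hM, rfl⟩ := rep V hV
    obtain ⟨M', hM', rfl⟩ := rep V' hV'
    exact soloBlind_fib_card_le_two_of_other three zsf hgood hM hM' (hdist M hM) (hdist M' hM') hVV'
  have f22 : ∀ V₁ ∈ W, ∀ V₂ ∈ W, ∀ V₃ ∈ W, V₁ ≠ V₂ → V₁ ≠ V₃ → V₂ ≠ V₃ →
      ¬ (2 ≤ (soloBlindFib h S τ V₁).card ∧ 2 ≤ (soloBlindFib h S τ V₂).card) := by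
    rintro V₁ hV₁ V₂ hV₂ V₃ hV₃ n₁₂ n₁₃ n₂₃ ⟨two₁, two₂⟩
    obtain ⟨M₁, hM₁, hM₁V, a₁, ha₁, a₂, ha₂S, ha₁₂, hav⟩ := soloBlind_twin_of_two_le_fib two₁
    obtain ⟨M₂, hM₂, hM₂V, b₁, hb₁, b₂, hb₂S, hb₁₂, hbv⟩ := soloBlind_twin_of_two_le_fib two₂
    obtain ⟨M₃, hM₃, hM₃V⟩ := rep V₃ hV₃
    subst hM₁V hM₂V hM₃V
    exact soloBlind_triangle_two_twins three zsf hgood hM₁ hM₂ hM₃ (hdist _ hM₁) (hdist _ hM₂) (hdist _ hM₃)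
      n₁₂ n₁₃ n₂₃ ha₁ ha₂S ha₁₂ hav hb₁ hb₂S hb₁₂ hbv
  rcases Nat.lt_or_ge W.card 1 with h0 | h1
  · have hW0 : W = ∅ := Finset.card_eq_zero.mp (show W.card = 0 by omega)
    rw [hsum, hW0, Finset.sum_empty]
    exact Nat.zero_le _
  rcases Nat.lt_or_ge W.card 2 with h1' | h2
  · obtain ⟨V, hWV⟩ := Finset.card_eq_one.mp (show W.card = 1 by omega)
    have hV : V ∈ W := by rw [hWV]; exact Finset.mem_singleton_self _
    rw [hsum, hWV, Finset.sum_singleton]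
    exact f4 V hV
  rcases Nat.lt_or_ge W.card 3 with h2' | h3
  · obtain ⟨V₁, V₂, n₁₂, hWV⟩ := Finset.card_eq_two.mp (show W.card = 2 by omega)
    have hV₁ : V₁ ∈ W := by rw [hWV]; exact Finset.mem_insert_self _ _
    have hV₂ : V₂ ∈ W := by rw [hWV]; exact Finset.mem_insert_of_mem (Finset.mem_singleton_self _)
    rw [hsum, hWV, Finset.sum_pair n₁₂]
    have b₁ := f2 V₁ hV₁ V₂ hV₂ n₁₂
    have b₂ := f2 V₂ hV₂ V₁ hV₁ n₁₂.symm
    omega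
  · obtain ⟨V₁, V₂, V₃, n₁₂, n₁₃, n₂₃, hWV⟩ := Finset.card_eq_three.mp (show W.card = 3 by omega)
    have hV₁ : V₁ ∈ W := by rw [hWV]; exact Finset.mem_insert_self _ _
    have hV₂ : V₂ ∈ W := by rw [hWV]; exact Finset.mem_insert_of_mem (Finset.mem_insert_self _ _)
    have hV₃ : V₃ ∈ W := by
      rw [hWV]; exact Finset.mem_insert_of_mem (Finset.mem_insert_of_mem (Finset.mem_singleton_self _))
    have hn : V₁ ∉ insert V₂ ({V₃} : Finset (Finset G)) := by
      simp only [Finset.mem_insert, Finset.mem_singleton, not_or]; exact ⟨n₁₂, n₁₃⟩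
    rw [hsum, hWV, Finset.sum_insert hn, Finset.sum_pair n₂₃]
    have b₁ := f2 V₁ hV₁ V₂ hV₂ n₁₂
    have b₂ := f2 V₂ hV₂ V₁ hV₁ n₁₂.symm
    have b₃ := f2 V₃ hV₃ V₁ hV₁ n₁₃.symm
    have d₁₂ := f22 V₁ hV₁ V₂ hV₂ V₃ hV₃ n₁₂ n₁₃ n₂₃
    have d₁₃ := f22 V₁ hV₁ V₃ hV₃ V₂ hV₂ n₁₃ n₁₂ n₂₃.symm
    have d₂₃ := f22 V₂ hV₂ V₃ hV₃ V₁ hV₁ n₂₃ n₁₂.symm n₁₃.symm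
    omega

/-- (E≤3) unconditionally: `N_3(τ) + 2 N_2(τ) + 4 N_1(τ) ≤ 4` for `h` zero-sum free on `S` and H-good `τ`. -/
theorem soloBlind_window_three (three : ∀ g : G, g + g + g = 0) (h : ι → G) (S : Finset ι)
    (zsf : ∀ T ⊆ S, T.Nonempty → ∑ i ∈ T, h i ≠ 0) (τ : G)
    (hgood : ∀ T ⊆ S, ∑ i ∈ T, h i ≠ τ + τ) :
    (soloBlindSeqRep h S 3 τ).card + 2 * (soloBlindSeqRep h S 2 τ).card +
      4 * (soloBlindSeqRep h S 1 τ).card ≤ 4 :=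
  soloBlind_window_three_of_H3 three h S zsf τ hgood
    (soloBlind_seqRep_three_card_le_four_of_hgood three h S zsf τ hgood)

/-- The same with the Kraft weights of the rank-`n` layers: `N_1/2 + N_2/4 + N_3/8 ≤ 1/2` in the form
`4 N_1 + 2 N_2 + N_3 ≤ 4` is `soloBlind_window_three`; in particular `N_2 ≤ 2` and `N_1 ≤ 1` for H-good `τ`. -/
theorem soloBlind_window_three_N2 (three : ∀ g : G, g + g + g = 0) (h : ι → G) (S : Finset ι)
    (zsf : ∀ T ⊆ S, T.Nonempty → ∑ i ∈ T, h i ≠ 0) (τ : G)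
    (hgood : ∀ T ⊆ S, ∑ i ∈ T, h i ≠ τ + τ) :
    (soloBlindSeqRep h S 2 τ).card ≤ 2 ∧ (soloBlindSeqRep h S 1 τ).card ≤ 1 := by
  have := soloBlind_window_three three h S zsf τ hgood
  constructor <;> omega



end Summit.MatrixMultiplication.MatrixMultiplication.Theorems
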